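import Summits.ResolutionOfSingularities.ResolutionOfSingularities.Theorems.WeightedInvariantIota3TauDescentBaseTwoDatum
import Summits.ResolutionOfSingularities.ResolutionOfSingularities.Theorems.WeightedInvariantLexMaxOrderDropOrder
import Summits.ResolutionOfSingularities.ResolutionOfSingularities.Theorems.WeightedInvariantHypersurfaceLocalGameEFTPointMoveChart
import Summits.ResolutionOfSingularities.ResolutionOfSingularities.Theorems.AQSHeightTwoSlopeFiltration
import Literature.AlgebraicGeometry.Resolution.CobordantBlowupExtReesBridge
import HarnessLib

/-!
# (desc-τ), CASE A′ ASSEMBLED MODULO THE FLAT BASE CHANGE OF THE COBORDANT BLOW-UP: no tie over a two-dimensional base essentially of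
# finite type over a field, GIVEN a base-change homomorphism of the extended Rees algebras that reflects orders
# (door `HypersurfaceCentreConstruction`, stmt-ResolutionOfSingularities-19897; registered stub `stub_keyRungGrHomLE_three`, gap (1) (desc-τ))

Topic: `Summits/ResolutionOfSingularities/ResolutionOfSingularities/Theorems`. Helper for the door item `HypersurfaceCentreConstruction`
(stmt-ResolutionOfSingularities-19897, route `WeightedInvariant`), line `local-engine`, def-free.  Assembly of the flat-pullback argument for case (A′)
of (desc-τ) from the bricks …Iota3TauDescentLowDim / …BaseTwo / …BaseTwoLexMax / …BaseTwoTransfer / …BaseTwoDatum, …TieNoDropSuccessor and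
`LexMaxOrderDrop.adicOrder_transform_lt_of_isLexMax`:

* **`Iota3.not_isTiePosition_map_of_baseChange`** — `T` regular local of dimension two, essentially of finite type over a field `k₀`;
  `φ : T → T'` local, formally smooth, essentially of finite type, `T'` regular.  ASSUME (hypothesis `hbc`, the ONE remaining brick) that for
  the relevant pairs `(t, s)` of `T` and `(y, x)` of `T'` with `𝒥ₙ((y, x); (r, q)) = 𝒥ₙ((t, s); (r, q))·T'` there is a ring homomorphism
  `ψ : T[t⁻¹, 𝒥ₙ((t,s);(r,q)) tⁿ] → T'[t⁻¹, 𝒥ₙ((y,x);(r,q)) tⁿ]` over `φ` with `ψ(t⁻¹) = t⁻¹`, carrying the vertex ideal onto generators of the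
  vertex ideal, and REFLECTING ORDERS at primes (`adicOrder (ψ b)_𝔫 ≤ adicOrder b_{ψ⁻¹𝔫}` — e.g. because `ψ` is the flat base change
  `B ⊗_T T' ≅ B'` with regular fibres).  THEN `(T', φ g)` is never a tie position.
  Proof: a tie has a presentation with plane `𝔪_T T'` (…BaseTwo), whose weights/filtration are those of the base datum `(t, s; r, q; rν)`, `ν ≥ 2`
  (…BaseTwoDatum); the transform `g_T = g t^{rν}` of `g` in `B_T` is `t⁻¹`-saturated (`𝒥_{rν+1} ⊆ 𝔪^{ν+1}`, `AQSHeightTwo.le_pow_of_weights_le`)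
  and maps to a transform of `φ g`; the tie yields a successor `𝔫` of `B'` over `𝔪_{T'}` off the vertex with `ν ≤ ord_𝔫 ψ(g_T)`
  (`IsTiePresentation.exists_successor_le_adicOrder`); its contraction `ψ⁻¹𝔫` is a successor of `B_T` over `𝔪_T` off the vertex with
  `ν ≤ ord (g_T)` by order reflection — contradicting the Abramovich–Quek–Schober drop `ord < ν` on the two-dimensional `T`.

[OURS · L1 W4.3 · (desc-τ) case A′, assembly modulo base change]  Replaces the role of NO printed item; NOT a statement of the manuscript under
review [claim: Hironaka2017, status: under-review]; candidates stay candidates; AI work, weaker than expert review.  No definition; no axiom; `hbc` is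
a hypothesis (the base-change brick), not a fact.

## References

* D. Abramovich, M. H. Quek, B. Schober, arXiv:2507.01232 (2025), Thm 1.3 (3), Thm 3.5, §5. [AbramovichQuekSchober2025]
* J. Włodarczyk, *Functorial resolution by torus actions*, arXiv:2203.03090, §2.3.9, §3.3. [Wlodarczyk2022]
-/

noncomputable section

set_option linter.dupNamespace false -- mandated namespace `Summit.<Summit>.<Problem>` of this single-conjunct summit

open IsLocalRing Literature.AlgebraicGeometry.Resolution
open Summit.ResolutionOfSingularities.ResolutionOfSingularities.Theorems
open Summit.ResolutionOfSingularities.ResolutionOfSingularities.Theorems.ContactCylinder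
open scoped LaurentPolynomial

namespace Summit.ResolutionOfSingularities.ResolutionOfSingularities.Cruxes.HypersurfaceCentreConstruction.LocalEngine

namespace Iota3

section Assembly

variable (T T' : Type) [CommRing T] [CommRing T'] [IsRegularLocalRing T] [IsRegularLocalRing T'] [Algebra T T']
  [IsLocalHom (algebraMap T T')] [Algebra.FormallySmooth T T'] [Algebra.EssFiniteType T T']

omit [IsRegularLocalRing T] [IsRegularLocalRing T'] [Algebra T T'] [IsLocalHom (algebraMap T T')] [Algebra.FormallySmooth T T']
  [Algebra.EssFiniteType T T'] [CommRing T'] in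
/-- **The transform `a tⁿ` of an element of the `n`-th piece**: for `a ∈ 𝒥ₙ(u; w)` the Laurent monomial `a tⁿ` lies in `B = T[t⁻¹, 𝒥ₙ tⁿ]`,
`a = (t⁻¹)ⁿ · (a tⁿ)` in `B`, and `t⁻¹ ∣ a tⁿ` in `B` forces `a ∈ 𝒥ₙ₊₁(u; w)`. [cite: Wlodarczyk2022, §3.3] -/
theorem exists_transform_of_mem {m : ℕ} (u : Fin m → T) (w : Fin m → ℕ) {n : ℕ} (hn : 0 < n) {a : T}
    (ha : a ∈ weightedMonomialIdeal u w n) :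
    ∃ G : extReesAlgebra (weightedMonomialIdeal u w),
      (G : T[T;T⁻¹]) = LaurentPolynomial.C a * LaurentPolynomial.T (n : ℤ) ∧
      algebraMap T (extReesAlgebra (weightedMonomialIdeal u w)) a = extReesAlgebra.tInv (weightedMonomialIdeal u w) ^ n * G ∧
      (extReesAlgebra.tInv (weightedMonomialIdeal u w) ∣ G → a ∈ weightedMonomialIdeal u w (n + 1)) := by
  refine ⟨⟨LaurentPolynomial.C a * LaurentPolynomial.T (n : ℤ), extReesAlgebra.C_mul_T_mem _ hn ha⟩, rfl, ?_, ?_⟩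
  · apply Subtype.ext
    change LaurentPolynomial.C a = (LaurentPolynomial.T (-1)) ^ n * (LaurentPolynomial.C a * LaurentPolynomial.T (n : ℤ))
    rw [LaurentPolynomial.T_pow, mul_left_comm, ← LaurentPolynomial.T_add]
    have h0 : ((n : ℤ) * (-1) + (n : ℤ)) = 0 := by ring
    rw [h0, LaurentPolynomial.T_zero, mul_one]
  · rintro ⟨c, hc⟩
    have hmem : (c : T[T;T⁻¹]) ∈ extReesAlgebra (weightedMonomialIdeal u w) := c.2
    have hc' : (c : T[T;T⁻¹]) = LaurentPolynomial.C a * LaurentPolynomial.T ((n + 1 : ℕ) : ℤ) := by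
      have h1 : LaurentPolynomial.C a * LaurentPolynomial.T (n : ℤ) = LaurentPolynomial.T (-1) * (c : T[T;T⁻¹]) :=
        congrArg Subtype.val hc
      have h2 : (c : T[T;T⁻¹]) = LaurentPolynomial.T 1 * (LaurentPolynomial.T (-1) * (c : T[T;T⁻¹])) := by
        rw [← mul_assoc, ← LaurentPolynomial.T_add]; norm_num [LaurentPolynomial.T_zero]
      rw [h2, ← h1, mul_left_comm, ← LaurentPolynomial.T_add]
      congr 2
      push_cast; ring
    rw [hc', extReesAlgebra_weightedMonomialIdeal_eq_extendedRees] at hmem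
    have h := (IdealFiltration.C_mul_T_mem_extendedRees_iff (F := weightedFiltration u w)).mp hmem
    rwa [← weightedMonomialIdeal_eq_weightedFiltration_ideal] at h

/-- **NO TIE OVER A TWO-DIMENSIONAL BASE (essentially of finite type over a field), MODULO THE BASE-CHANGE BRICK `hbc`.**  See the module
docstring. [OURS · (desc-τ) case A′ assembled modulo base change] [cite: AbramovichQuekSchober2025, Thm 1.3 (3)] -/
theorem not_isTiePosition_map_of_baseChange (k₀ : Type) [Field k₀] [Algebra k₀ T] [Algebra.EssFiniteType k₀ T]
    (hdimT : ringKrullDim T = (2 : ℕ)) {g : T}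
    (hbc : ∀ (x y : T') (t s : T) (q r : ℕ),
      (∀ n, weightedMonomialIdeal ![y, x] ![r, q] n = (weightedMonomialIdeal ![t, s] ![r, q] n).map (algebraMap T T')) →
      ∃ ψ : extReesAlgebra (weightedMonomialIdeal ![t, s] ![r, q]) →+* extReesAlgebra (weightedMonomialIdeal ![y, x] ![r, q]),
        (∀ a : T, ψ (algebraMap T _ a) = algebraMap T' _ (algebraMap T T' a)) ∧
        ψ (extReesAlgebra.tInv _) = extReesAlgebra.tInv _ ∧
        extReesAlgebra.vertexIdeal (weightedMonomialIdeal ![y, x] ![r, q]) ≤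
          (extReesAlgebra.vertexIdeal (weightedMonomialIdeal ![t, s] ![r, q])).map ψ ∧
        ∀ (𝔫 : Ideal (extReesAlgebra (weightedMonomialIdeal ![y, x] ![r, q]))) [𝔫.IsPrime]
          (b : extReesAlgebra (weightedMonomialIdeal ![t, s] ![r, q])),
          adicOrder (algebraMap _ (Localization.AtPrime 𝔫) (ψ b)) ≤
            adicOrder (algebraMap _ (Localization.AtPrime (𝔫.comap ψ)) b)) :
    ¬ IsTiePosition T' (algebraMap T T' g) := by
  classical
  intro ht
  -- the located presentation and the base datum
  obtain ⟨hdimT', -, x, y, z, q, r, lam, ν, h, hxy, -, -, hfν, hfν1⟩ := isTiePosition_map_dichotomy_of_ringKrullDim_eq_two T T' hdimT ht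
  obtain ⟨h2, hgν, hgν1, t, s, hst, hq, hqr, hlex, hfil⟩ :=
    exists_base_datum_of_isTiePresentation T T' k₀ hdimT hdimT' ht h hxy hfν hfν1
  obtain ⟨ψ, hψa, hψt, hψV, hψord⟩ := hbc x y t s q r hfil
  have hr : 0 < r := lt_of_lt_of_le hq hqr
  have hν : 0 < ν := by omega
  -- the transform of `g` downstairs
  have hadm : g ∈ weightedMonomialIdeal ![t, s] ![r, q] (r * ν) := by
    obtain ⟨-, -, -, -, -, -, hadm, -⟩ := hlex
    exact hadm (Ideal.mem_span_singleton_self g)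
  obtain ⟨G, -, hgG, hsat⟩ := exists_transform_of_mem T ![t, s] ![r, q] (Nat.mul_pos hr hν) hadm
  have ht𝔪 : t ∈ maximalIdeal T := hst ▸ Ideal.subset_span (Set.mem_insert_of_mem _ (Set.mem_singleton _))
  have hs𝔪 : s ∈ maximalIdeal T := hst ▸ Ideal.subset_span (Set.mem_insert _ _)
  have hGsat : ¬ extReesAlgebra.tInv (weightedMonomialIdeal ![t, s] ![r, q]) ∣ G := fun hdvd => by
    have hmem := hsat hdvd
    have hle := AQSHeightTwo.le_pow_of_weights_le (S := T) ht𝔪 hs𝔪 (q := r) (r := q) (W := r) le_rfl hqr ν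
    rw [Nat.mul_comm ν r] at hle
    exact hgν1 (hle hmem)
  -- the transform upstairs is `ψ G`
  have hfg : algebraMap T' (extReesAlgebra (weightedMonomialIdeal ![y, x] ![r, q])) (algebraMap T T' g) =
      extReesAlgebra.tInv (weightedMonomialIdeal ![y, x] ![r, q]) ^ (r * ν) * ψ G := by
    rw [← hψa, hgG, map_mul, map_pow, hψt]
  -- the no-drop successor of the tie
  have hdim3 : ringKrullDim T' = 3 := by rw [hdimT']; rfl
  obtain ⟨𝔫, htInv𝔫, -, huT, hcomap, -, hord⟩ := h.exists_successor_le_adicOrder hdim3 hfν hfν1 hfg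
  -- its contraction to `B_T`
  set 𝔫₀ : Ideal (extReesAlgebra (weightedMonomialIdeal ![t, s] ![r, q])) := 𝔫.asIdeal.comap ψ with h𝔫₀
  have htInv₀ : extReesAlgebra.tInv (weightedMonomialIdeal ![t, s] ![r, q]) ∈ 𝔫₀ := by
    rw [h𝔫₀, Ideal.mem_comap, hψt]; exact htInv𝔫
  have hM₀ : (maximalIdeal T).map (algebraMap T (extReesAlgebra (weightedMonomialIdeal ![t, s] ![r, q]))) ≤ 𝔫₀ := by
    rw [Ideal.map_le_iff_le_comap]
    intro a ha
    have h1 : algebraMap T' (extReesAlgebra (weightedMonomialIdeal ![y, x] ![r, q])) (algebraMap T T' a) ∈ 𝔫.asIdeal := by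
      rw [← Ideal.mem_comap, hcomap]
      exact map_nonunit (algebraMap T T') a ha
    rw [Ideal.mem_comap, h𝔫₀, Ideal.mem_comap, hψa]
    exact h1
  have hV₀ : ¬ extReesAlgebra.vertexIdeal (weightedMonomialIdeal ![t, s] ![r, q]) ≤ 𝔫₀ := fun hle => by
    apply huT
    have h1 : LocalGameEFTPointMove.uT ![y, x] ![r, q] 1 ∈ extReesAlgebra.vertexIdeal (weightedMonomialIdeal ![y, x] ![r, q]) := by
      refine Ideal.subset_span ⟨q, hq, x, ?_, rfl⟩
      exact mem_weightedMonomialIdeal_self ![y, x] ![r, q] 1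
    have h2 : (extReesAlgebra.vertexIdeal (weightedMonomialIdeal ![t, s] ![r, q])).map ψ ≤ 𝔫.asIdeal := by
      rw [Ideal.map_le_iff_le_comap]; exact hle
    exact h2 (hψV h1)
  -- order reflection along `ψ` and the two-dimensional drop
  have hordG : (ν : ℕ∞) ≤ adicOrder (algebraMap _ (Localization.AtPrime 𝔫₀) G) := hord.trans (hψord 𝔫.asIdeal G)
  have hgord : adicOrder g = (ν : ℕ∞) :=
    le_antisymm ((adicOrder_le_iff g ν).mpr hgν1) ((le_adicOrder_iff g ν).mpr hgν)
  have hdim2 : ringKrullDim T = 2 := by rw [hdimT]; rfl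
  have hdrop := LexMaxOrderDrop.adicOrder_transform_lt_of_isLexMax hdim2 hlex (by simp) h2 hgord 𝔫₀ htInv₀ hM₀ hV₀ (r * ν) G hgG hGsat
  exact absurd (hordG.trans_lt hdrop) (lt_irrefl _)

end Assembly

end Iota3

end Summit.ResolutionOfSingularities.ResolutionOfSingularities.Cruxes.HypersurfaceCentreConstruction.LocalEngine

end
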